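import Summits.MatrixMultiplication.MatrixMultiplication.Theorems.SoloInformedRectangle

/-!
# Pair structure and the rigidity engines of the alignment lemma (m = 2 coprime, every chart)

This work, §8.8 (T10) (gen 107). Three purely algebraic facts over an abelian group `G` (the odd part `S¹`; "no
2-torsion" = `hG : ∀ x, x = -x → x = 0`), in the `SignEq`/`Adm` language of `SoloInformedWitness`:

* `cross_of_adm_adm` — (E) at `(i, j, k)` and at `(i, j', k)` share the cell `c k i`; eliminating it, one of the four
  classes `[x ± x']` (`x = a i j`, `x' = a i j'`) equals one of `[y ± y']` (`y = b j k`, `y' = b j' k`): the 2-sets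
  `P(i) = {[a i j ± a i j']}` and `Q(k) = {[b j k ± b j' k]}` are CROSS-INTERSECTING (`Data.cross`).
* `signEq_of_mem_inter` — the single-class intersection lemma: if `p ≁ q` then `{[v + p], [v - p]} ∩ {[v + q], [v - q]}`
  contains at most one sign class (rigid columns of a poor pair: the partner's class is a function of the base value).
* `eq_zero_or_eq_zero_of_signEq_sub_add` — the I⁺ exclusivity: `p_t - p_s ~ p_st` and `p_t + p_s ~ p_st` force
  `p_s = 0 ∨ p_t = 0`; and `locked_split` — the I⁺/I⁻ dichotomy `[v + b] ∈ {[v + a ± d]} ⟹ (b - a ~ d) ∨ 2v = -a - b ∓ d`.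
References: this work §8.8 (T10); CohnUmans2013 (arXiv:1207.6528) Def. 12.
-/

namespace Summit.MatrixMultiplication.MatrixMultiplication.Theorems.TwistedTPP

namespace FibreLines

variable {ι G : Type*} [AddCommGroup G]

/-- Bookkeeping: `c = d` and `a - b = c - d` (resp. `a + b = c - d`) give `SignEq a b`. -/
theorem signEq_of_forms {a b c d : G} (h : c = d) (e : a - b = c - d ∨ a + b = c - d) : SignEq a b := by
  rw [h, sub_self] at e
  rcases e with e | e
  · exact Or.inl (sub_eq_zero.mp e)
  · exact Or.inr (eq_neg_of_add_eq_zero_left e)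

/-- **Cross-intersection.** `Adm x y w` and `Adm x' y' w` (same third entry) give: one of `x + x'`, `x - x'` is
sign-equivalent to one of `y + y'`, `y - y'`. [this work, §8.8 (T10)(a)] -/
theorem cross_of_adm_adm {x x' y y' w : G} (h : Adm x y w) (h' : Adm x' y' w) :
    SignEq (x + x') (y + y') ∨ SignEq (x + x') (y - y') ∨ SignEq (x - x') (y + y') ∨
      SignEq (x - x') (y - y') := by
  rcases h.signEq_add_or_sub with (h1 | h1) | (h1 | h1) <;>
    rcases h'.signEq_add_or_sub with (h2 | h2) | (h2 | h2)
  · exact Or.inr (Or.inr (Or.inr (signEq_of_forms (h1.symm.trans h2) (Or.inr (by abel)))))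
  · exact Or.inl (signEq_of_forms (h1.symm.trans h2) (Or.inr (by abel)))
  · exact Or.inr (Or.inr (Or.inl (signEq_of_forms (h1.symm.trans h2) (Or.inr (by abel)))))
  · exact Or.inr (Or.inl (signEq_of_forms (h1.symm.trans h2) (Or.inr (by abel))))
  · exact Or.inl (signEq_of_forms (h1.symm.trans h2).symm (Or.inr (by abel)))
  · exact Or.inr (Or.inr (Or.inr (signEq_of_forms (h1.symm.trans h2).symm (Or.inr (by abel)))))
  · exact Or.inr (Or.inl (signEq_of_forms (h1.symm.trans h2).symm (Or.inr (by abel))))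
  · exact Or.inr (Or.inr (Or.inl (signEq_of_forms (h1.symm.trans h2).symm (Or.inr (by abel)))))
  · exact Or.inr (Or.inr (Or.inl (signEq_of_forms (h1.symm.trans h2) (Or.inl (by abel)))))
  · exact Or.inr (Or.inl (signEq_of_forms (h1.symm.trans h2) (Or.inl (by abel))))
  · exact Or.inr (Or.inr (Or.inr (signEq_of_forms (h1.symm.trans h2) (Or.inl (by abel)))))
  · exact Or.inl (signEq_of_forms (h1.symm.trans h2) (Or.inl (by abel)))
  · exact Or.inr (Or.inl (signEq_of_forms (h1.symm.trans h2).symm (Or.inl (by abel))))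
  · exact Or.inr (Or.inr (Or.inl (signEq_of_forms (h1.symm.trans h2).symm (Or.inl (by abel)))))
  · exact Or.inl (signEq_of_forms (h1.symm.trans h2).symm (Or.inl (by abel)))
  · exact Or.inr (Or.inr (Or.inr (signEq_of_forms (h1.symm.trans h2).symm (Or.inl (by abel)))))

/-- **The pair structure of (E).** For all `i j j' k`: `P(i) ∩ Q(k) ≠ ∅`, i.e. one of `[a i j ± a i j']` equals one
of `[b j k ± b j' k]`. [this work, §8.8 (T10)(a)] -/
theorem Data.cross (D : Data ι G) (i j j' k : ι) :
    SignEq (D.a i j + D.a i j') (D.b j k + D.b j' k) ∨ SignEq (D.a i j + D.a i j') (D.b j k - D.b j' k) ∨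
      SignEq (D.a i j - D.a i j') (D.b j k + D.b j' k) ∨ SignEq (D.a i j - D.a i j') (D.b j k - D.b j' k) :=
  cross_of_adm_adm (D.adm_eqn i j k) (D.adm_eqn i j' k)

/-- `SignEq a (-b) ↔ SignEq a b`. -/
theorem signEq_neg_right {a b : G} : SignEq a (-b) ↔ SignEq a b := by
  constructor
  · rintro (h | h)
    · exact Or.inr h
    · exact Or.inl (by rw [h, neg_neg])
  · rintro (h | h)
    · exact Or.inr (by rw [h, neg_neg])
    · exact Or.inl h

/-- `SignEq (-a) b ↔ SignEq a b`. -/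
theorem signEq_neg_left {a b : G} : SignEq (-a) b ↔ SignEq a b := by
  constructor
  · rintro (h | h)
    · exact Or.inr (by rw [← h, neg_neg])
    · exact Or.inl (neg_injective h)
  · rintro (h | h)
    · exact Or.inr (by rw [h])
    · exact Or.inl (by rw [h, neg_neg])

/-- Auxiliary: `v + a ~ v + b` and `v - a ~ v - b` give `a ~ b`, or both `a ~ v` and `b ~ v`. -/
theorem signEq_or_of_shift (hG : ∀ x : G, x = -x → x = 0) {v a b : G}
    (h₁ : SignEq (v + a) (v + b)) (h₂ : SignEq (v - a) (v - b)) : SignEq a b ∨ (SignEq a v ∧ SignEq b v) := by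
  rcases signEq_pair_of_signEq_add_sub hG h₁ h₂ with ⟨hab, -⟩ | ⟨hav, hbv⟩
  · exact Or.inl hab
  · exact Or.inr ⟨hav, hbv⟩

/-- **Single-class intersection lemma.** If `p ≁ q` (no 2-torsion), any two elements whose classes lie in
`{[v + p], [v - p]} ∩ {[v + q], [v - q]}` are sign-equivalent: the intersection holds at most ONE class.
[this work, §8.8 (T10)(d)(ρ1)] -/
theorem signEq_of_mem_inter (hG : ∀ x : G, x = -x → x = 0) {v p q y y' : G} (hpq : ¬ SignEq p q)
    (hp : SignEq y (v + p) ∨ SignEq y (v - p)) (hq : SignEq y (v + q) ∨ SignEq y (v - q))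
    (hp' : SignEq y' (v + p) ∨ SignEq y' (v - p)) (hq' : SignEq y' (v + q) ∨ SignEq y' (v - q)) :
    SignEq y y' := by
  by_contra hne
  have key : ∀ {a b : G}, SignEq y (v + a) → SignEq y' (v - a) → SignEq y (v + b) → SignEq y' (v - b) →
      SignEq a b := by
    intro a b ha ha' hb hb'
    have h₁ : SignEq (v + a) (v + b) := ha.symm.trans hb
    have h₂ : SignEq (v - a) (v - b) := ha'.symm.trans hb'
    rcases signEq_or_of_shift hG h₁ h₂ with hab | ⟨hav, hbv⟩
    · exact hab
    · exact hav.trans hbv.symm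
  have np : ∀ {u : G}, SignEq y u → SignEq y' u → False := fun ha ha' => hne (ha.trans ha'.symm)
  rcases hp with hp | hp <;> rcases hp' with hp' | hp' <;> rcases hq with hq | hq <;>
    rcases hq' with hq' | hq'
  · exact np hp hp'
  · exact np hp hp'
  · exact np hp hp'
  · exact np hp hp'
  · exact np hq hq'
  · exact hpq (key (a := p) (b := q) hp hp' hq hq')
  · exact hpq (signEq_neg_right.mp (key (a := p) (b := (-q)) hp hp' (by rw [← sub_eq_add_neg]; exact hq) (by rw [sub_neg_eq_add]; exact hq')))
  · exact np hq hq'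
  · exact np hq hq'
  · exact hpq (signEq_neg_left.mp (key (a := (-p)) (b := q) (by rw [← sub_eq_add_neg]; exact hp) (by rw [sub_neg_eq_add]; exact hp') hq hq'))
  · exact hpq (signEq_neg_left.mp (signEq_neg_right.mp (key (a := (-p)) (b := (-q)) (by rw [← sub_eq_add_neg]; exact hp) (by rw [sub_neg_eq_add]; exact hp') (by rw [← sub_eq_add_neg]; exact hq) (by rw [sub_neg_eq_add]; exact hq'))))
  · exact np hq hq'
  · exact np hp hp'
  · exact np hp hp'
  · exact np hp hp'
  · exact np hp hp'

/-- **I⁺ exclusivity.** `p_t - p_s ~ d` and `p_t + p_s ~ d` force `p_s = 0 ∨ p_t = 0` (no 2-torsion): on a value-cell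
where only v-free identities occur, two locked partners cannot show both a same-sign and an opposite-sign column.
[this work, §8.8 (T10)(d)(ρ3)] -/
theorem eq_zero_or_eq_zero_of_signEq_sub_add (hG : ∀ x : G, x = -x → x = 0) {ps pt d : G}
    (h₁ : SignEq (pt - ps) d) (h₂ : SignEq (pt + ps) d) : ps = 0 ∨ pt = 0 := by
  rcases h₁.trans h₂.symm with h | h
  · left
    have h0 : ps + ps = 0 := by
      have e : ps + ps = (pt + ps) - (pt - ps) := by abel
      rw [e, ← h, sub_self]
    exact hG ps (eq_neg_of_add_eq_zero_left h0)
  · right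
    have h0 : pt + pt = 0 := by
      have e : pt + pt = (pt - ps) + (pt + ps) := by abel
      rw [e, h, neg_add_cancel]
    exact hG pt (eq_neg_of_add_eq_zero_left h0)

/-- **I⁺/I⁻ dichotomy.** If `[v + b] ∈ {[v + a + d], [v + a - d]}` then either the v-free identity `b - a ~ d` (I⁺)
holds, or `2v` is pinned: `v + v = -a - b - d ∨ v + v = -a - b + d` (I⁻). [this work, §8.8 (T10)(d)(ρ3)] -/
theorem locked_split {v a b d : G} (h : SignEq (v + b) (v + a + d) ∨ SignEq (v + b) (v + a - d)) :
    SignEq (b - a) d ∨ (v + v = -a - b - d ∨ v + v = -a - b + d) := by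
  rcases h with (h | h) | (h | h)
  · left; left
    have e : b - a = (v + b) - (v + a + d) + d := by abel
    rw [e, h, sub_self, zero_add]
  · right; left
    have e : v + v = (v + b) + (v + a + d) + (-a - b - d) := by abel
    rw [e, h, neg_add_cancel, zero_add]
  · left; right
    have e : b - a = (v + b) - (v + a - d) - d := by abel
    rw [e, h, sub_self, zero_sub]
  · right; right
    have e : v + v = (v + b) + (v + a - d) + (-a - b + d) := by abel
    rw [e, h, neg_add_cancel, zero_add]

end FibreLines

end Summit.MatrixMultiplication.MatrixMultiplication.Theorems.TwistedTPP
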